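import Summits.BirchSwinnertonDyer.Rank1Residual.X2.CongruenceTransferCoveredNonsplit
import Summits.BirchSwinnertonDyer.Rank1Residual.X2.CongruenceTransferMultiplicativeDerived
import Summits.BirchSwinnertonDyer.Rank1Residual.X2.CongruentPartnerAnomalous
import HarnessLib

/-!
# Class X2 (odd multiplicative Eisenstein prime): route G with a COVERED partner at a NON-SPLIT
# prime — the partner's non-anomaly READ OFF THE CONGRUENCE (gen 14's `hna'` binder discharged)
# (cell `b2b-bsdres`, unit `b2b-bsdres-eisenstein-p2`, gen 15)

HONEST FRAMING (run/shared/lean/b2b/bsd-rank1-residual/, verbatim in every file): the goal of the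
cell is to DELETE the COMBINATION-SHAPED residual classes of the Birch–Swinnerton-Dyer formula for
ALL analytic-rank `≤ 1` elliptic curves over `ℚ` — "full BSD formula for every rank `≤ 1` curve in
class `C`" assembled STRICTLY from published theorems — so that the rank-`≤ 1` remainder becomes
exactly the CONSTRUCTION-SHAPED classes, which are TYPED (missing-input `Prop`s), NOT attempted.
This is not "finishing BSD". Research route; NO CLAIM BEYOND STATED CLASSES; nothing here changes a
label; X2b and X2c stay CONSTRUCTION-SHAPED (route G is a per-pair CERTIFICATE route). Theorems only
(no definition, no named fact, nothing asserted).

## What this file proves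

Gen 14 (`X2/CongruenceTransferCoveredNonsplit.lean`) closed Mazur's main conjecture / `BSD(E₀, p)`
at a NON-SPLIT X2 pair `(E₀, p)` from a congruent GOOD relative `E₀'` whose main conjecture is
Castella–Grossi–Skinner 2025 Thm. A, with the relative's NON-ANOMALY `a_p(E₀') ≢ 1 (mod p)` as a
per-pair hypothesis `hna'`. Gen 15's `X2/CongruentPartnerAnomalous.lean` proves that hypothesis from
the congruence itself (`not_dvd_frobeniusTrace_sub_one_of_torsionIso_of_not_split`: at a non-split
`p ‖ N₀` the characters of `E₀[p]|_{G_p}` are `ωδ, δ`, `δ(Frob) = −1`, so a good relative has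
`a_p ≡ −1`), granted only the twisted Tate uniformisation A41 — which these theorems already carry
(`hT`). Hence the forms below, IDENTICAL to gen 14's except that `hna'` is GONE: the per-pair inputs
of the covered-partner route are now exactly the CERTIFICATES (analytic invariants of both pairs,
`TorsionIso`, `Σ₀`/`δ` data, one integer inequality) and PUBLISHED statements.

* `mazurMainConjecture_partner_of_torsionIso_of_not_split` — at a non-split X2 pair EVERY good
  congruent relative satisfies Mazur's main conjecture (CGS Thm. A, hypotheses from the congruence),
* `mazurMainConjectureAt_of_coveredRelative_nonsplit` (both ranks),
* `bsdp_of_coveredRelative_rankZero_nonsplit` (`BSD(E₀, p)` at `r_an = 0`),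
* `missingInputB_of_coveredRelative_nonsplit` (X2b bookkeeping form).
* §2 (mult–mult pairs): `split_iff_split_of_torsionIso` (splitness at `p` is a congruence invariant)
  makes the trivial-zero terms `+ e_p(E₀') − e_p(E₀)` of gen 13/14's mult–mult shift CANCEL:
  `algebraicInvariantsEq_of_torsionIso_mult_mult_sameSign` and
  `mazurMainConjectureAt_of_closedRelative_mult_sameSign` take `k = k' + Σ_{v∈Σ₀}(δ' − δ)`.

References: [CastellaGrossiSkinner2025] Thm. A; [GreenbergVatsal2000] Thm. (1.4), §1 (5)–(7), §2
pp. 14–15, 20–27; [Wuthrich2014] Thm. 16; [SteinWuthrich2013] Thm. 6.1; [Serre1972] §1.11–1.12;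
[SilvermanATAEC1994] Ch. V 5.2–5.4; HOME/b2b-bsdres-eisenstein-p2/X2-GAP.md §20.
-/

set_option autoImplicit false

noncomputable section

open scoped Classical MatrixGroups ModularForm

open PowerSeries CongruenceSubgroup WeierstrassCurve NumberField IsDedekindDomain
  Literature.NumberTheory.EllipticCurves
  Literature.NumberTheory.EllipticCurves.ModularForms
  Literature.NumberTheory.EllipticCurves.Rank1Residual
  Literature.NumberTheory.EllipticCurves.Rank1Residual.Typed
  Literature.NumberTheory.EllipticCurves.Wuthrich2014
  Literature.NumberTheory.EllipticCurves.SteinWuthrich2013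
  Literature.NumberTheory.EllipticCurves.Greenberg1999
  Literature.NumberTheory.EllipticCurves.GreenbergVatsal2000
  Literature.NumberTheory.EllipticCurves.CastellaGrossiSkinner2025
  Summit.BirchSwinnertonDyer.BirchSwinnertonDyer.Theorems.Rank1ResidualX1Defs
  Summit.BirchSwinnertonDyer.Rank1Residual.X1.MuLambda
  Summit.BirchSwinnertonDyer.Rank1Residual.X1.MuPart
  Summit.BirchSwinnertonDyer.Rank1Residual.X1.ParitySqueeze
  Summit.BirchSwinnertonDyer.Rank1Residual.X1.TamagawaSqueeze
  Summit.BirchSwinnertonDyer.Rank1Residual.X1.CongruenceTransfer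
  Summit.BirchSwinnertonDyer.Rank1Residual.X2.CongruentLambdaShiftMultiplicative
  Summit.BirchSwinnertonDyer.Rank1Residual.X2.CongruentPartnerAnomalous

namespace Summit.BirchSwinnertonDyer.Rank1Residual.X2

section NonSplitCongruence

variable {W W' : WeierstrassCurve ℚ} [W.IsElliptic] [W.IsGloballyMinimal]
  [W'.IsElliptic] [W'.IsGloballyMinimal] {p : ℕ} [Fact p.Prime]
  (S₀ : Finset (HeightOneSpectrum (𝓞 ℚ)))

/-- **At a NON-SPLIT X2 pair, EVERY good congruent relative satisfies Mazur's main conjecture**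
(Castella–Grossi–Skinner 2025 Thm. A, tree fact `thmA_charIdeal_eq_padicLFunction`): the relative is
good, reducible, ordinary and non-anomalous by `CongruentPartnerAnomalous.covered_partner_of_torsionIso_of_not_split`,
and gen 14's `mazurMainConjecture_of_thmA` applies. [cite: CastellaGrossiSkinner2025, Theorem A]
[cite: Serre1972, §1.11 (1), Prop. 11–12] -/
theorem mazurMainConjecture_partner_of_torsionIso_of_not_split (hA : thmA_charIdeal_eq_padicLFunction)
    (hT : Silverman1994_thmV53_corV54_tateUniformisation.{0}) (hp2 : p ≠ 2)
    (hmult : W.HasMultiplicativeReductionAtPrime p)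
    (hns : ¬ W.HasSplitMultiplicativeReductionAtPrime p) (hred : ¬ W.HasIrreducibleModPGaloisRep p)
    (hgood' : W'.HasGoodReductionAtPrime p) (hiso : TorsionIso W W' p) : MazurMainConjecture W' p :=
  have hp : 2 < p := lt_of_le_of_ne (Fact.out : p.Prime).two_le (Ne.symm hp2)
  have h := CongruentPartnerAnomalous.covered_partner_of_torsionIso_of_not_split hT hp2 hmult hns hred
    hgood' hiso
  mazurMainConjecture_of_thmA W' p hA hp hgood' h.1 h.2.2

/-- **NON-SPLIT X2 pair, COVERED relative ⇒ Mazur's main conjecture at the pair, with the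
relative's non-anomaly read off the congruence** (both ranks): `(E₀, p)` non-split multiplicative,
`E₀[p]` reducible, `p ≠ 2`, `μ_an(E₀) = 0`, `λ_an(E₀) = n`; `(E₀', p)` GOOD with `E₀[p] ≅ E₀'[p]`
(hence reducible, ordinary AND non-anomalous: `CongruentPartnerAnomalous`), `μ_an = 0`, `λ_an = n'`;
`Σ₀ ∌ p` ⊇ bad primes of both; ONE integer inequality `n ≤ n' + Σ_{v∈Σ₀}(δ' − δ)`. Published
inputs: CGS 2025 Thm. A, Wuthrich 2014 Thm. 16 (both forms), modularity, A40/A41, GV (5)–(7) at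
`p ‖ N`, Prop. 2.5, p. 15, p. 26, (7), p. 8. Gen 14's
`mazurMainConjectureAt_of_coveredRelative_of_not_split` with `hna'` DISCHARGED.
[cite: CastellaGrossiSkinner2025, Theorem A]
[cite: GreenbergVatsal2000, Thm. (1.4), §1 (5)–(7), pp. 14–15, §2 pp. 20–27]
[cite: Wuthrich2014, Thm. 16 (p. 397)] [cite: Serre1972, §1.11 (1), Prop. 11–12] -/
theorem mazurMainConjectureAt_of_coveredRelative_nonsplit
    (hA : thmA_charIdeal_eq_padicLFunction)
    (hWu : thm16_charIdeal_dvd_multiplicative_of_reducible)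
    (hW16 : Wuthrich2014.charIdeal_dvd_padicLFunction)
    (hpar : nonempty_modularParametrizationData)
    (hT : Silverman1994_thmV53_corV54_tateUniformisation.{0})
    (hT' : Silverman1994_thmV53_tateUniformisation.{0})
    (hAm : lambda_nonPrimitive_eq_add_sum_delta_multiplicative)
    (hBm : datumSelmer_divisible_of_finite_torsionBy) (hF : datumStrictSelmer_lt_datumSelmer_of_split)
    (hGV : imKummer_ge_greenbergCondition_at_p) (hA7 : lambda_nonPrimitive_eq_add_sum_delta)
    (hB : divisible_nonPrimitiveSelmerInfty_of_mu_eq_zero) (hp2 : p ≠ 2)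
    (hmult : W.HasMultiplicativeReductionAtPrime p)
    (hns : ¬ W.HasSplitMultiplicativeReductionAtPrime p) (hred : ¬ W.HasIrreducibleModPGaloisRep p)
    {n : ℕ} (hμ0 : AnalyticMuLE W p 0) (hlam : AnalyticLambdaEq W p n)
    (hgood' : W'.HasGoodReductionAtPrime p) {n' : ℕ}
    (hμ0' : X1.MuPart.AnalyticMuLE W' p 0) (hlam' : X1.ParitySqueeze.AnalyticLambdaEq W' p n')
    (hS₀ : ∀ v ∈ S₀, ((p : ℕ) : 𝓞 ℚ) ∉ v.asIdeal)
    (hS : ∀ v : HeightOneSpectrum (𝓞 ℚ), v ∉ S₀ → ((p : ℕ) : 𝓞 ℚ) ∉ v.asIdeal →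
      W.HasGoodReductionAt v)
    (hS' : ∀ v : HeightOneSpectrum (𝓞 ℚ), v ∉ S₀ → ((p : ℕ) : 𝓞 ℚ) ∉ v.asIdeal →
      W'.HasGoodReductionAt v)
    (hiso : TorsionIso W W' p) {k : ℕ}
    (hk : (k : ℤ) = n' + ∑ v ∈ S₀, ((delta W' p v : ℤ) - (delta W p v : ℤ))) (hn : n ≤ k) :
    X2.MazurMainConjectureAt W p :=
  mazurMainConjectureAt_of_coveredRelative_of_not_split S₀ hA hWu hW16 hpar hT hT' hAm hBm hF hGV hA7
    hB hp2 hmult hns hred hμ0 hlam hgood'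
    (CongruentPartnerAnomalous.not_dvd_frobeniusTrace_sub_one_of_torsionIso_of_not_split hT hp2 hmult
      hns hred hgood' hiso)
    hμ0' hlam' hS₀ hS hS' hiso hk hn

/-- **NON-SPLIT X2b pair (rank `0`), COVERED relative ⇒ `BSD(E₀, p)`, `hna'` discharged** —
gen 14's `bsdp_of_coveredRelative_rankZero_of_not_split` with the relative's non-anomaly from the
congruence; last step Stein–Wuthrich Thm. 6.1, Greenberg–Stevens, GZK, modularity.
[cite: CastellaGrossiSkinner2025, Theorem A]
[cite: GreenbergVatsal2000, Thm. (1.4), §1 (5)–(7), pp. 14–15, §2 pp. 20–27]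
[cite: Wuthrich2014, Thm. 16 (p. 397)] [cite: SteinWuthrich2013, Thm. 6.1 (p. 20)]
[cite: Serre1972, §1.11 (1), Prop. 11–12] -/
theorem bsdp_of_coveredRelative_rankZero_nonsplit (hA : thmA_charIdeal_eq_padicLFunction)
    (hWu : thm16_charIdeal_dvd_multiplicative_of_reducible)
    (hW16 : Wuthrich2014.charIdeal_dvd_padicLFunction)
    (hJs : thm61_splitMultiplicative) (hJn : thm61_nonsplitMultiplicative)
    (hHs : exists_isSplitMultCanonical) (hHn : exists_isMultCanonical)
    (hGZK : rank_eq_analyticRank_of_analyticRank_le_one) (hmod : hasEntireLFunction_rat)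
    (hpar : nonempty_modularParametrizationData)
    (hT : Silverman1994_thmV53_corV54_tateUniformisation.{0})
    (hT' : Silverman1994_thmV53_tateUniformisation.{0})
    (hAm : lambda_nonPrimitive_eq_add_sum_delta_multiplicative)
    (hBm : datumSelmer_divisible_of_finite_torsionBy) (hF : datumStrictSelmer_lt_datumSelmer_of_split)
    (hGV : imKummer_ge_greenbergCondition_at_p) (hA7 : lambda_nonPrimitive_eq_add_sum_delta)
    (hB : divisible_nonPrimitiveSelmerInfty_of_mu_eq_zero)
    (W W' : WeierstrassCurve ℚ) [W.IsElliptic] [W.IsGloballyMinimal] [W'.IsElliptic]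
    [W'.IsGloballyMinimal] (p : ℕ) [Fact p.Prime] (hGS : greenberg_stevens (W := W) (p := p))
    (hp2 : p ≠ 2) (hmult : W.HasMultiplicativeReductionAtPrime p)
    (hns : ¬ W.HasSplitMultiplicativeReductionAtPrime p)
    (hred : ¬ W.HasIrreducibleModPGaloisRep p) (hr : W.analyticRank = 0) {n : ℕ}
    (hμ0 : AnalyticMuLE W p 0) (hlam : AnalyticLambdaEq W p n)
    (hgood' : W'.HasGoodReductionAtPrime p) {n' : ℕ}
    (hμ0' : X1.MuPart.AnalyticMuLE W' p 0) (hlam' : X1.ParitySqueeze.AnalyticLambdaEq W' p n')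
    (hS₀ : ∀ v ∈ S₀, ((p : ℕ) : 𝓞 ℚ) ∉ v.asIdeal)
    (hS : ∀ v : HeightOneSpectrum (𝓞 ℚ), v ∉ S₀ → ((p : ℕ) : 𝓞 ℚ) ∉ v.asIdeal →
      W.HasGoodReductionAt v)
    (hS' : ∀ v : HeightOneSpectrum (𝓞 ℚ), v ∉ S₀ → ((p : ℕ) : 𝓞 ℚ) ∉ v.asIdeal →
      W'.HasGoodReductionAt v)
    (hiso : TorsionIso W W' p) {k : ℕ}
    (hk : (k : ℤ) = n' + ∑ v ∈ S₀, ((delta W' p v : ℤ) - (delta W p v : ℤ))) (hn : n ≤ k) :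
    BSDp W p :=
  bsdp_of_coveredRelative_rankZero_of_not_split S₀ hA hWu hW16 hJs hJn hHs hHn hGZK hmod hpar hT hT'
    hAm hBm hF hGV hA7 hB W W' p hGS hp2 hmult hns hred hr hμ0 hlam hgood'
    (CongruentPartnerAnomalous.not_dvd_frobeniusTrace_sub_one_of_torsionIso_of_not_split hT hp2 hmult
      hns hred hgood' hiso)
    hμ0' hlam' hS₀ hS hS' hiso hk hn

/-- **NON-SPLIT X2b pair: its TYPED INPUT `MissingInputB W p` from a COVERED relative, `hna'`
discharged** (bookkeeping form for the Partition).
[cite: CastellaGrossiSkinner2025, Theorem A] [cite: GreenbergVatsal2000, Thm. (1.4), §2 pp. 26–27]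
[cite: Wuthrich2014, Thm. 16 (p. 397)] [cite: Serre1972, §1.11 (1), Prop. 11–12] -/
theorem missingInputB_of_coveredRelative_nonsplit (hA : thmA_charIdeal_eq_padicLFunction)
    (hWu : thm16_charIdeal_dvd_multiplicative_of_reducible)
    (hW16 : Wuthrich2014.charIdeal_dvd_padicLFunction)
    (hpar : nonempty_modularParametrizationData)
    (hT : Silverman1994_thmV53_corV54_tateUniformisation.{0})
    (hT' : Silverman1994_thmV53_tateUniformisation.{0})
    (hAm : lambda_nonPrimitive_eq_add_sum_delta_multiplicative)
    (hBm : datumSelmer_divisible_of_finite_torsionBy) (hF : datumStrictSelmer_lt_datumSelmer_of_split)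
    (hGV : imKummer_ge_greenbergCondition_at_p) (hA7 : lambda_nonPrimitive_eq_add_sum_delta)
    (hB : divisible_nonPrimitiveSelmerInfty_of_mu_eq_zero)
    (W W' : WeierstrassCurve ℚ) [W.IsElliptic] [W.IsGloballyMinimal] [W'.IsElliptic]
    [W'.IsGloballyMinimal] (p : ℕ) [Fact p.Prime] (hc : CellB W p)
    (hns : ¬ W.HasSplitMultiplicativeReductionAtPrime p) {n : ℕ}
    (hμ0 : AnalyticMuLE W p 0) (hlam : AnalyticLambdaEq W p n)
    (hgood' : W'.HasGoodReductionAtPrime p) {n' : ℕ}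
    (hμ0' : X1.MuPart.AnalyticMuLE W' p 0) (hlam' : X1.ParitySqueeze.AnalyticLambdaEq W' p n')
    (hS₀ : ∀ v ∈ S₀, ((p : ℕ) : 𝓞 ℚ) ∉ v.asIdeal)
    (hS : ∀ v : HeightOneSpectrum (𝓞 ℚ), v ∉ S₀ → ((p : ℕ) : 𝓞 ℚ) ∉ v.asIdeal →
      W.HasGoodReductionAt v)
    (hS' : ∀ v : HeightOneSpectrum (𝓞 ℚ), v ∉ S₀ → ((p : ℕ) : 𝓞 ℚ) ∉ v.asIdeal →
      W'.HasGoodReductionAt v)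
    (hiso : TorsionIso W W' p) {k : ℕ}
    (hk : (k : ℤ) = n' + ∑ v ∈ S₀, ((delta W' p v : ℤ) - (delta W p v : ℤ))) (hn : n ≤ k) :
    MissingInputB W p :=
  mazurMainConjectureAt_of_coveredRelative_nonsplit S₀ hA hWu hW16 hpar hT hT' hAm hBm hF hGV hA7 hB
    hc.2.1.1 hc.2.1.2.2 hns hc.2.1.2.1 hμ0 hlam hgood' hμ0' hlam' hS₀ hS hS' hiso hk hn

end NonSplitCongruence

/-! ## §2. Mult–mult pairs: the trivial-zero terms of the shift cancel -/

section MultMultSameSign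

variable {W W' : WeierstrassCurve ℚ} [W.IsElliptic] [W.IsGloballyMinimal]
  [W'.IsElliptic] [W'.IsGloballyMinimal] {p : ℕ} [Fact p.Prime]
  (S₀ : Finset (HeightOneSpectrum (𝓞 ℚ)))

/-- The trivial-zero terms of the mult–mult shift cancel: for congruent multiplicative `W, W'` at an
odd Eisenstein `p`, `e_p(W') − e_p(W) = 0` (`CongruentPartnerAnomalous.split_iff_split_of_torsionIso`).
[cite: GreenbergVatsal2000, §2 pp. 14–15] -/
theorem trivialZero_shift_eq_zero
    (hT : Silverman1994_thmV53_corV54_tateUniformisation.{0})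
    (hT' : Silverman1994_thmV53_tateUniformisation.{0}) (hp2 : p ≠ 2)
    (hmult : W.HasMultiplicativeReductionAtPrime p) (hmult' : W'.HasMultiplicativeReductionAtPrime p)
    (hred : ¬ W.HasIrreducibleModPGaloisRep p) (hiso : TorsionIso W W' p) :
    ((if W'.HasSplitMultiplicativeReductionAtPrime p then (1 : ℤ) else 0)
      - (if W.HasSplitMultiplicativeReductionAtPrime p then (1 : ℤ) else 0)) = 0 := by
  have hiff := CongruentPartnerAnomalous.split_iff_split_of_torsionIso hT hT' hp2 hmult hmult' hred hiso
  by_cases hs : W.HasSplitMultiplicativeReductionAtPrime p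
  · rw [if_pos hs, if_pos (hiff.mp hs), sub_self]
  · rw [if_neg hs, if_neg (fun h ↦ hs (hiff.mpr h)), sub_self]

/-- **X2 target, ANY multiplicative relative with exact invariants — shift WITHOUT trivial-zero
terms**: as gen 14's `algebraicInvariantsEq_of_torsionIso_mult_mult_of_facts` but with
**`k = k' + Σ_{v∈Σ₀}(δ' − δ)`** (the members are split or non-split together).
[cite: GreenbergVatsal2000, Thm. (1.4), §1 (5)–(7), pp. 14–15, §2 pp. 20–27]
[cite: Wuthrich2014, Thm. 16 (p. 397)] -/
theorem algebraicInvariantsEq_of_torsionIso_mult_mult_sameSign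
    (hWu : thm16_charIdeal_dvd_multiplicative_of_reducible)
    (hpar : nonempty_modularParametrizationData)
    (hT : Silverman1994_thmV53_corV54_tateUniformisation.{0})
    (hT' : Silverman1994_thmV53_tateUniformisation.{0})
    (hAm : lambda_nonPrimitive_eq_add_sum_delta_multiplicative)
    (hBm : datumSelmer_divisible_of_finite_torsionBy) (hF : datumStrictSelmer_lt_datumSelmer_of_split)
    (hp2 : p ≠ 2) (hmult : W.HasMultiplicativeReductionAtPrime p)
    (hred : ¬ W.HasIrreducibleModPGaloisRep p) (hμ0 : AnalyticMuLE W p 0)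
    (hmult' : W'.HasMultiplicativeReductionAtPrime p)
    (hS₀ : ∀ v ∈ S₀, ((p : ℕ) : 𝓞 ℚ) ∉ v.asIdeal)
    (hS : ∀ v : HeightOneSpectrum (𝓞 ℚ), v ∉ S₀ → ((p : ℕ) : 𝓞 ℚ) ∉ v.asIdeal →
      W.HasGoodReductionAt v)
    (hS' : ∀ v : HeightOneSpectrum (𝓞 ℚ), v ∉ S₀ → ((p : ℕ) : 𝓞 ℚ) ∉ v.asIdeal →
      W'.HasGoodReductionAt v)
    {k' : ℕ} (hinv' : AlgebraicInvariantsEq W' p k') (hiso : TorsionIso W W' p) {k : ℕ}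
    (hk : (k : ℤ) = k' + ∑ v ∈ S₀, ((delta W' p v : ℤ) - (delta W p v : ℤ))) :
    AlgebraicInvariantsEq W p k := by
  refine algebraicInvariantsEq_of_torsionIso_mult_mult_of_facts S₀ hWu hpar hT hT' hAm hBm hF hp2 hmult
    hred hμ0 hmult' hS₀ hS hS' hinv' hiso ?_
  have h0 := trivialZero_shift_eq_zero hT hT' hp2 hmult hmult' hred hiso
  rw [hk]
  linear_combination -h0

/-- **Mazur's main conjecture at the X2 pair from a CLOSED multiplicative relative — shift WITHOUT
trivial-zero terms**: gen 14's `mazurMainConjectureAt_of_closedRelative_mult_of_facts` with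
**`k = k' + Σ_{v∈Σ₀}(δ' − δ)`**. [cite: GreenbergVatsal2000, Thm. (1.4), §1 (5)–(7), pp. 14–15, §2 pp. 20–27]
[cite: Wuthrich2014, Thm. 16 (p. 397)] -/
theorem mazurMainConjectureAt_of_closedRelative_mult_sameSign
    (hWu : thm16_charIdeal_dvd_multiplicative_of_reducible)
    (hpar : nonempty_modularParametrizationData)
    (hT : Silverman1994_thmV53_corV54_tateUniformisation.{0})
    (hT' : Silverman1994_thmV53_tateUniformisation.{0})
    (hAm : lambda_nonPrimitive_eq_add_sum_delta_multiplicative)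
    (hBm : datumSelmer_divisible_of_finite_torsionBy) (hF : datumStrictSelmer_lt_datumSelmer_of_split)
    (hp2 : p ≠ 2) (hmult : W.HasMultiplicativeReductionAtPrime p)
    (hred : ¬ W.HasIrreducibleModPGaloisRep p) {n : ℕ} (hμ0 : AnalyticMuLE W p 0)
    (hlam : AnalyticLambdaEq W p n)
    (hmult' : W'.HasMultiplicativeReductionAtPrime p) (hMC' : X2.MazurMainConjectureAt W' p)
    {n' k' : ℕ} (hμ0' : AnalyticMuLE W' p 0) (hlam' : AnalyticLambdaEq W' p n')
    (hk'N : ¬ W'.HasSplitMultiplicativeReductionAtPrime p → k' = n')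
    (hk'S : W'.HasSplitMultiplicativeReductionAtPrime p → k' + 1 = n')
    (hS₀ : ∀ v ∈ S₀, ((p : ℕ) : 𝓞 ℚ) ∉ v.asIdeal)
    (hS : ∀ v : HeightOneSpectrum (𝓞 ℚ), v ∉ S₀ → ((p : ℕ) : 𝓞 ℚ) ∉ v.asIdeal →
      W.HasGoodReductionAt v)
    (hS' : ∀ v : HeightOneSpectrum (𝓞 ℚ), v ∉ S₀ → ((p : ℕ) : 𝓞 ℚ) ∉ v.asIdeal →
      W'.HasGoodReductionAt v)
    (hiso : TorsionIso W W' p) {k : ℕ}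
    (hk : (k : ℤ) = k' + ∑ v ∈ S₀, ((delta W' p v : ℤ) - (delta W p v : ℤ)))
    (hkN : ¬ W.HasSplitMultiplicativeReductionAtPrime p → n ≤ k)
    (hkS : W.HasSplitMultiplicativeReductionAtPrime p → n ≤ k + 1) : X2.MazurMainConjectureAt W p := by
  refine mazurMainConjectureAt_of_closedRelative_mult_of_facts S₀ hWu hpar hT hT' hAm hBm hF hp2 hmult
    hred hμ0 hlam hmult' hMC' hμ0' hlam' hk'N hk'S hS₀ hS hS' hiso ?_ hkN hkS
  have h0 := trivialZero_shift_eq_zero hT hT' hp2 hmult hmult' hred hiso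
  rw [hk]
  linear_combination -h0

end MultMultSameSign

end Summit.BirchSwinnertonDyer.Rank1Residual.X2

end
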